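import Summits.ResolutionOfSingularities.ResolutionOfSingularities.Theorems.EquisingularLiftEquisingularLiftNatSubchainPointResolutionLetters
import Summits.ResolutionOfSingularities.ResolutionOfSingularities.Theorems.EquisingularLiftEquisingularLiftNatDirZeroDefs
import Summits.ResolutionOfSingularities.ResolutionOfSingularities.Theorems.EquisingularLiftEquisingularLiftNatLetteredPrefixResolution
import Summits.ResolutionOfSingularities.ResolutionOfSingularities.Theorems.EquisingularLiftEquisingularLiftNatNDStrataTower
import HarnessLib

/-!
# [OURS · L1 W4.5(b) · EL♮(3) · SPEC K6 v10 — THE JUNCTION INSTANTIATED ON stub-2's K5⁶ `hres` TEXT v1.1] `prefixReach6Draft_mono_reach`, `prefixReach6Draft_then_rounds`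

res-L1-w45b-idea-1 g27 (IDEATOR 1; SPEC custody) · 2026-08-28 · companion of `Cruxes/EquisingularLiftNatThree/NDLeavesRungK6Junction.lean` 16bcfcd4ed9f3014
(`junction6`, here INLINED — Cruxes modules are not built library targets, so nothing under `Cruxes/` is imported) and `SPEC-K6-v10-PLAN.md` dd8614218a1b6d17.  OURS · counted 0 · AI-written, weaker than expert review · nothing of [Hironaka2017] asserted ·
**EL♮(3) NOT proved** · pure logic; no `sorry`, no instance, no notation.

WHAT.  §A is a VERBATIM COPY (type-checking scaffold, namespaced here; the tree decl will be 027's Defs8 `PrefixReachKeyLetterP6` = this block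
instantiated, desk R54) of stub-2 g16's `PrefixReach6Draft` from `L/res-L1-w45b-stub-2/g16/K56-hres-v1.1.lean` sha16 df0014a1b76d223c (l.46–173; desk R54:
architecture ACCEPTED).  §B proves, over that literal text, the two lemmas that make the K6-2P6 RUNG a three-line proof:
* `prefixReach6Draft_mono_reach` — the prefix predicate is MONOTONE in the `Reach` parameter (a motive closed under more towers is closed under fewer):
  Defs8's instance at `Reach := ReachTowerBTriplePrime` feeds the engine's instance at `Reach := B‴ ∨ toric` by `Or.inl` (K6-2P's adapter, now one lemma);
* `prefixReach6Draft_then_rounds` — PREFIX at `(F, ρ, T)` + the ND rounds' motive-level reach `hQ'` (✓ `ND.rounds_resolve`) from `(F, ρ, T)` to `(F', ρ', T')`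
  ⇒ PREFIX at `(F', ρ', T')`, for any `Reach ⊇ ND.ReachToric n` (`Or.inr`): inside the `∀ Q` it is ONE application of `hQ'` to the collapsed motive
  `∃ Ls Kp, Q … Ls Kp`, whose `ND.RoundClosed`ness is READ OFF clause (Pc) — i.e. (R1)/(R2) of the SPEC plan hold for text v1.1 AS WRITTEN;
RUNG⁶ (lead-2's pen, after Defs8 + the K5⁶ engine theorem land) is then: `engine6 … (prefixReach6Draft_then_rounds (Or.inr-instance) (prefixReach6Draft_mono_reach
(Or.inl-instance) hpre) hQ') hreg' …` modulo the token substitution `PrefixReach6Draft ↦ <Defs8 name>` (if Defs8 FIXES `Reach := B‴`, `mono_reach` is restated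
between Defs8's def and the engine's `∀ Q` hypothesis by the same proof term).  If text v1.2 adds/changes clauses, only the binder list `hD hPc hPL hi hO hii hHR`
of §B changes (one name per clause); the two proof terms touch (Pc) alone.  §C is a PROBE that `PrefixReach6Draft … F' ρ' T'` is accepted VERBATIM as the
`∀ Q` conjunct of the TREE ENGINE ✓ p669625 `target_elnat_of_letteredPrefixResolution`'s last hypothesis (the copy and the engine agree token for token).
-/

set_option linter.dupNamespace false -- mandated namespace of this single-conjunct summit
set_option linter.overlappingInstances false

noncomputable section

open CategoryTheory CategoryTheory.Limits AlgebraicGeometry TopologicalSpace Topology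
open Literature.AlgebraicGeometry.Resolution
open AlgebraicGeometry.Scheme.IdealSheafData
open Summit.ResolutionOfSingularities.ResolutionOfSingularities.Cruxes.EquisingularLiftNat.Sections

namespace Summit.ResolutionOfSingularities.ResolutionOfSingularities.Cruxes.EquisingularLiftNatThree.ToricTowers.K6Junction.V11

/-! ## §A  VERBATIM COPY of stub-2 g16's `PrefixReach6Draft` (K56-hres-v1.1.lean df0014a1b76d223c l.46–173) — scaffold only -/

/-- **K5⁶ `hres` text v1 — `PrefixReach6Draft`** (parametric in `Reach`, `ReachL`, `LS`, `Open` exactly as the engine is; Defs8's `PrefixReach6 k n H ι F' ρ' T'`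
:= this at `Reach := ReachTowerBTriplePrime`, `ReachL := ReachTowerBQuadPrime ℙⁿ`, `LS :=` the hyperplane-letter predicate of `PrefixReachBQuadPrime`,
`Open := OpeningCert k n H ι` (S10's opening, text v1.1)). [OURS · L1 W4.5b · draft, no mathematical content] -/
def PrefixReach6Draft (k : Type) [Field k] [IsAlgClosed k] (n : ℕ) (H : AlgebraicGeometry.Scheme.{0})
    (ι : H ⟶ (Literature.AlgebraicGeometry.Motives.projectiveSpace n k).left)
    (Reach : ∀ (F₁ F₂ : AlgebraicGeometry.Scheme.{0}), (F₂ ⟶ F₁) → F₁ → Set F₂ → ∀ (F₉ : AlgebraicGeometry.Scheme.{0}), (F₉ ⟶ F₂) → Set F₉ → Prop)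
    (ReachL : ∀ (F₂ : AlgebraicGeometry.Scheme.{0}), (F₂ ⟶ (Literature.AlgebraicGeometry.Motives.projectiveSpace n k).left) →
      (Literature.AlgebraicGeometry.Motives.projectiveSpace n k).left → Set F₂ → List (Set F₂) → ∀ (F₉ : AlgebraicGeometry.Scheme.{0}), (F₉ ⟶ F₂) → Set F₉ → Prop)
    (LS : ∀ (F₂ : AlgebraicGeometry.Scheme.{0}), (F₂ ⟶ (Literature.AlgebraicGeometry.Motives.projectiveSpace n k).left) →
      (Literature.AlgebraicGeometry.Motives.projectiveSpace n k).left → List (Set F₂) → Prop)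
    (Open : ∀ (F₃ : AlgebraicGeometry.Scheme.{0}), (F₃ ⟶ (Literature.AlgebraicGeometry.Motives.projectiveSpace n k).left) → Set F₃ → List (Set F₃) →
      Option (Set F₃ × Set F₃ × Set F₃) → Prop)
    (F' : AlgebraicGeometry.Scheme.{0}) (ρ' : F' ⟶ (Literature.AlgebraicGeometry.Motives.projectiveSpace n k).left) (T' : Set F') : Prop :=
  ∀ Q : (∀ F₁ : AlgebraicGeometry.Scheme.{0}, (F₁ ⟶ (Literature.AlgebraicGeometry.Motives.projectiveSpace n k).left) → Set F₁ → List (Set F₁) →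
      Option (Set F₁ × Set F₁ × Set F₁) → Prop),
    -- (0) START: no letters, no tag
    Q (Literature.AlgebraicGeometry.Motives.projectiveSpace n k).left (𝟙 (Literature.AlgebraicGeometry.Motives.projectiveSpace n k).left) (Set.range ι) [] none →
    -- (D) DROP: forget listed letters (any sublist, as a set of names) and/or the tag
    (∀ (F₁ : AlgebraicGeometry.Scheme.{0}) (ρ : F₁ ⟶ (Literature.AlgebraicGeometry.Motives.projectiveSpace n k).left) (T₁ : Set F₁) (Ls Ls' : List (Set F₁))
        (Kp Kp' : Option (Set F₁ × Set F₁ × Set F₁)),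
      Q F₁ ρ T₁ Ls Kp → (∀ L ∈ Ls', L ∈ Ls) → (Kp' = Kp ∨ Kp' = none) → Q F₁ ρ T₁ Ls' Kp') →
    -- (Pc) K5′'s POINT STEP + `Reach`-moves (PrefixReachBQuadPrime's first clause), from ANY slots, letters and tag DROPPED
    (∀ (F₁ F₂ : AlgebraicGeometry.Scheme.{0}) (ρ : F₁ ⟶ (Literature.AlgebraicGeometry.Motives.projectiveSpace n k).left) (T₁ : Set F₁) (Ls : List (Set F₁))
        (Kp : Option (Set F₁ × Set F₁ × Set F₁))
        (x : ↥(AlgebraicGeometry.Scheme.IdealSheafData.vanishingIdeal (⟨closure T₁, isClosed_closure⟩ : TopologicalSpace.Closeds F₁)).subscheme) (υ : F₂ ⟶ F₁)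
        (hx : IsClosed ({((AlgebraicGeometry.Scheme.IdealSheafData.vanishingIdeal
          (⟨closure T₁, isClosed_closure⟩ : TopologicalSpace.Closeds F₁)).subschemeι x : F₁)} : Set F₁)), Q F₁ ρ T₁ Ls Kp →
      ¬ IsRegularLocalRing ((AlgebraicGeometry.Scheme.IdealSheafData.vanishingIdeal
          (⟨closure T₁, isClosed_closure⟩ : TopologicalSpace.Closeds F₁)).subscheme.presheaf.stalk x) →
      IsRegularLocalRing (F₁.presheaf.stalk ((AlgebraicGeometry.Scheme.IdealSheafData.vanishingIdeal
          (⟨closure T₁, isClosed_closure⟩ : TopologicalSpace.Closeds F₁)).subschemeι x)) → Literature.AlgebraicGeometry.Resolution.IsBlowup υ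
        (AlgebraicGeometry.Scheme.IdealSheafData.vanishingIdeal (⟨{((AlgebraicGeometry.Scheme.IdealSheafData.vanishingIdeal
            (⟨closure T₁, isClosed_closure⟩ : TopologicalSpace.Closeds F₁)).subschemeι x : F₁)}, hx⟩ : TopologicalSpace.Closeds F₁)) →
      Q F₂ (υ ≫ ρ) (closure (υ ⁻¹' (T₁ \ {((AlgebraicGeometry.Scheme.IdealSheafData.vanishingIdeal
          (⟨closure T₁, isClosed_closure⟩ : TopologicalSpace.Closeds F₁)).subschemeι x : F₁)}))) [] none ∧ (∀ (F₉ : AlgebraicGeometry.Scheme.{0}) (β : F₉ ⟶ F₂) (T₉ : Set F₉),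
        Reach F₁ F₂ υ ((AlgebraicGeometry.Scheme.IdealSheafData.vanishingIdeal (⟨closure T₁, isClosed_closure⟩ : TopologicalSpace.Closeds F₁)).subschemeι x)
          (closure (υ ⁻¹' (T₁ \ {((AlgebraicGeometry.Scheme.IdealSheafData.vanishingIdeal
            (⟨closure T₁, isClosed_closure⟩ : TopologicalSpace.Closeds F₁)).subschemeι x : F₁)}))) F₉ β T₉ → Q F₉ ((β ≫ υ) ≫ ρ) T₉ [] none)) →
    -- (PL) A⁗: at the INITIAL stage only, LETTERED `ReachL`-towers after a good point step (PrefixReachBQuadPrime's second clause), conclusion at `[] none`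
    (∀ (F₂ : AlgebraicGeometry.Scheme.{0}) (x₀ : ↥(AlgebraicGeometry.Scheme.IdealSheafData.vanishingIdeal
          (⟨closure (Set.range ι), isClosed_closure⟩ : TopologicalSpace.Closeds (Literature.AlgebraicGeometry.Motives.projectiveSpace n k).left)).subscheme)
        (υ : F₂ ⟶ (Literature.AlgebraicGeometry.Motives.projectiveSpace n k).left) (hx₀ : IsClosed ({((AlgebraicGeometry.Scheme.IdealSheafData.vanishingIdeal
          (⟨closure (Set.range ι), isClosed_closure⟩ : TopologicalSpace.Closeds (Literature.AlgebraicGeometry.Motives.projectiveSpace n k).left)).subschemeι x₀ : (Literature.AlgebraicGeometry.Motives.projectiveSpace n k).left)} : Set (Literature.AlgebraicGeometry.Motives.projectiveSpace n k).left))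
        (Ls₂ : List (Set F₂)), ¬ IsRegularLocalRing ((AlgebraicGeometry.Scheme.IdealSheafData.vanishingIdeal
          (⟨closure (Set.range ι), isClosed_closure⟩ : TopologicalSpace.Closeds (Literature.AlgebraicGeometry.Motives.projectiveSpace n k).left)).subscheme.presheaf.stalk x₀) →
      IsRegularLocalRing ((Literature.AlgebraicGeometry.Motives.projectiveSpace n k).left.presheaf.stalk ((AlgebraicGeometry.Scheme.IdealSheafData.vanishingIdeal
          (⟨closure (Set.range ι), isClosed_closure⟩ : TopologicalSpace.Closeds (Literature.AlgebraicGeometry.Motives.projectiveSpace n k).left)).subschemeι x₀ : (Literature.AlgebraicGeometry.Motives.projectiveSpace n k).left)) →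
      Literature.AlgebraicGeometry.Resolution.IsBlowup υ (AlgebraicGeometry.Scheme.IdealSheafData.vanishingIdeal (⟨{((AlgebraicGeometry.Scheme.IdealSheafData.vanishingIdeal
          (⟨closure (Set.range ι), isClosed_closure⟩ : TopologicalSpace.Closeds (Literature.AlgebraicGeometry.Motives.projectiveSpace n k).left)).subschemeι x₀ : (Literature.AlgebraicGeometry.Motives.projectiveSpace n k).left)}, hx₀⟩ : TopologicalSpace.Closeds (Literature.AlgebraicGeometry.Motives.projectiveSpace n k).left)) →
      LS F₂ υ ((AlgebraicGeometry.Scheme.IdealSheafData.vanishingIdeal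
          (⟨closure (Set.range ι), isClosed_closure⟩ : TopologicalSpace.Closeds (Literature.AlgebraicGeometry.Motives.projectiveSpace n k).left)).subschemeι x₀ : (Literature.AlgebraicGeometry.Motives.projectiveSpace n k).left) Ls₂ →
      ∀ (F₉ : AlgebraicGeometry.Scheme.{0}) (β : F₉ ⟶ F₂) (T₉ : Set F₉), ReachL F₂ υ ((AlgebraicGeometry.Scheme.IdealSheafData.vanishingIdeal
          (⟨closure (Set.range ι), isClosed_closure⟩ : TopologicalSpace.Closeds (Literature.AlgebraicGeometry.Motives.projectiveSpace n k).left)).subschemeι x₀ : (Literature.AlgebraicGeometry.Motives.projectiveSpace n k).left) (closure (υ ⁻¹' (Set.range ι \ {((AlgebraicGeometry.Scheme.IdealSheafData.vanishingIdeal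
          (⟨closure (Set.range ι), isClosed_closure⟩ : TopologicalSpace.Closeds (Literature.AlgebraicGeometry.Motives.projectiveSpace n k).left)).subschemeι x₀ : (Literature.AlgebraicGeometry.Motives.projectiveSpace n k).left)}))) Ls₂ F₉ β T₉ →
        Q F₉ (β ≫ υ) T₉ [] none) →
    -- (i) LETTERED POINT STEP at a closed non-regular point of `T̃`, regular on `F`: at most ONE listed letter THROUGH the point (`Lt = some L`: nested section,
    --     `L̃` regular at the point), every other listed letter AWAY, the tag's three letters AWAY; letters `↦ St`, tag `↦ St`, optional birth of `E_x = υ⁻¹{x}`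
    (∀ (F₁ F₂ : AlgebraicGeometry.Scheme.{0}) (ρ : F₁ ⟶ (Literature.AlgebraicGeometry.Motives.projectiveSpace n k).left) (T₁ : Set F₁) (Ls : List (Set F₁))
        (Kp : Option (Set F₁ × Set F₁ × Set F₁)) (Lt : Option (Set F₁))
        (x : ↥(AlgebraicGeometry.Scheme.IdealSheafData.vanishingIdeal (⟨closure T₁, isClosed_closure⟩ : TopologicalSpace.Closeds F₁)).subscheme) (υ : F₂ ⟶ F₁)
        (hx : IsClosed ({((AlgebraicGeometry.Scheme.IdealSheafData.vanishingIdeal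
          (⟨closure T₁, isClosed_closure⟩ : TopologicalSpace.Closeds F₁)).subschemeι x : F₁)} : Set F₁)), Q F₁ ρ T₁ Ls Kp →
      ¬ IsRegularLocalRing ((AlgebraicGeometry.Scheme.IdealSheafData.vanishingIdeal
          (⟨closure T₁, isClosed_closure⟩ : TopologicalSpace.Closeds F₁)).subscheme.presheaf.stalk x) →
      IsRegularLocalRing (F₁.presheaf.stalk ((AlgebraicGeometry.Scheme.IdealSheafData.vanishingIdeal
          (⟨closure T₁, isClosed_closure⟩ : TopologicalSpace.Closeds F₁)).subschemeι x)) →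
      (∀ L ∈ Ls, ((AlgebraicGeometry.Scheme.IdealSheafData.vanishingIdeal (⟨closure T₁, isClosed_closure⟩ : TopologicalSpace.Closeds F₁)).subschemeι x : F₁) ∈ closure L →
        Lt = some L) →
      (∀ L : Set F₁, Lt = some L → L ∈ Ls ∧ ∀ e : ↥(redSub F₁ (closure L) isClosed_closure), (redSubι F₁ (closure L) isClosed_closure e : F₁) =
          ((AlgebraicGeometry.Scheme.IdealSheafData.vanishingIdeal (⟨closure T₁, isClosed_closure⟩ : TopologicalSpace.Closeds F₁)).subschemeι x : F₁) →
        IsRegularLocalRing ((redSub F₁ (closure L) isClosed_closure).presheaf.stalk e)) →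
      (∀ K A C : Set F₁, Kp = some (K, A, C) →
        ((AlgebraicGeometry.Scheme.IdealSheafData.vanishingIdeal (⟨closure T₁, isClosed_closure⟩ : TopologicalSpace.Closeds F₁)).subschemeι x : F₁) ∉ closure K ∧
        ((AlgebraicGeometry.Scheme.IdealSheafData.vanishingIdeal (⟨closure T₁, isClosed_closure⟩ : TopologicalSpace.Closeds F₁)).subschemeι x : F₁) ∉ closure A ∧
        ((AlgebraicGeometry.Scheme.IdealSheafData.vanishingIdeal (⟨closure T₁, isClosed_closure⟩ : TopologicalSpace.Closeds F₁)).subschemeι x : F₁) ∉ closure C) →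
      Literature.AlgebraicGeometry.Resolution.IsBlowup υ
        (AlgebraicGeometry.Scheme.IdealSheafData.vanishingIdeal (⟨{((AlgebraicGeometry.Scheme.IdealSheafData.vanishingIdeal
            (⟨closure T₁, isClosed_closure⟩ : TopologicalSpace.Closeds F₁)).subschemeι x : F₁)}, hx⟩ : TopologicalSpace.Closeds F₁)) →
      ∀ Ls' : List (Set F₂),
        (Ls' = Ls.map (fun L => closure (υ ⁻¹' (L \ {((AlgebraicGeometry.Scheme.IdealSheafData.vanishingIdeal
            (⟨closure T₁, isClosed_closure⟩ : TopologicalSpace.Closeds F₁)).subschemeι x : F₁)}))) ∨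
         Ls' = Ls.map (fun L => closure (υ ⁻¹' (L \ {((AlgebraicGeometry.Scheme.IdealSheafData.vanishingIdeal
            (⟨closure T₁, isClosed_closure⟩ : TopologicalSpace.Closeds F₁)).subschemeι x : F₁)}))) ++
            [υ ⁻¹' {((AlgebraicGeometry.Scheme.IdealSheafData.vanishingIdeal (⟨closure T₁, isClosed_closure⟩ : TopologicalSpace.Closeds F₁)).subschemeι x : F₁)}]) →
        Q F₂ (υ ≫ ρ) (closure (υ ⁻¹' (T₁ \ {((AlgebraicGeometry.Scheme.IdealSheafData.vanishingIdeal
            (⟨closure T₁, isClosed_closure⟩ : TopologicalSpace.Closeds F₁)).subschemeι x : F₁)}))) Ls'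
          (Kp.map (fun t => (closure (υ ⁻¹' (t.1 \ {((AlgebraicGeometry.Scheme.IdealSheafData.vanishingIdeal
              (⟨closure T₁, isClosed_closure⟩ : TopologicalSpace.Closeds F₁)).subschemeι x : F₁)})),
            closure (υ ⁻¹' (t.2.1 \ {((AlgebraicGeometry.Scheme.IdealSheafData.vanishingIdeal
              (⟨closure T₁, isClosed_closure⟩ : TopologicalSpace.Closeds F₁)).subschemeι x : F₁)})),
            closure (υ ⁻¹' (t.2.2 \ {((AlgebraicGeometry.Scheme.IdealSheafData.vanishingIdeal
              (⟨closure T₁, isClosed_closure⟩ : TopologicalSpace.Closeds F₁)).subschemeι x : F₁)})))))) →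
    -- (O) CERTIFIED OPENING (opaque here; Defs8: `Open := OpeningCert k n H ι`, S10's «birth of M♮ + P(x₀) + CAR + PROMOTE» certificate list, text v1.1)
    (∀ (F₃ : AlgebraicGeometry.Scheme.{0}) (ρ₃ : F₃ ⟶ (Literature.AlgebraicGeometry.Motives.projectiveSpace n k).left) (T₃ : Set F₃) (Ls₃ : List (Set F₃))
        (Kp₃ : Option (Set F₃ × Set F₃ × Set F₃)), Open F₃ ρ₃ T₃ Ls₃ Kp₃ → Q F₃ ρ₃ T₃ Ls₃ Kp₃) →
    -- (ii) PAIR ROUND at the transversal crossing curve `Z` of two listed letters `A ≠ B` (stage-level, (T-k)-free): `Z ⊆ T`, `T ⊄ Z`, `Z̃` regular, curve clause,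
    --      `F` regular at the closed points of `Z`; the tag is absent or HOSTS (its pair is `{A, B}`, its key letter is listed and is not a member); every other
    --      listed letter does not contain `Z` and meets it transversally (possibly not at all); letters `↦ St`, tag consumed, optional birth of `E_Z = υ'⁻¹ Z`
    (∀ (F₁ F₃ : AlgebraicGeometry.Scheme.{0}) (ρ : F₁ ⟶ (Literature.AlgebraicGeometry.Motives.projectiveSpace n k).left) (T₁ : Set F₁) (Ls : List (Set F₁))
        (Kp : Option (Set F₁ × Set F₁ × Set F₁)) (A B Z : Set F₁) (hZ : IsClosed Z) (υ' : F₃ ⟶ F₁),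
      Q F₁ ρ T₁ Ls Kp → A ∈ Ls → B ∈ Ls → A ≠ B →
      AlgebraicGeometry.Scheme.IdealSheafData.vanishingIdeal (⟨closure A, isClosed_closure⟩ : TopologicalSpace.Closeds F₁) ⊔
          AlgebraicGeometry.Scheme.IdealSheafData.vanishingIdeal (⟨closure B, isClosed_closure⟩ : TopologicalSpace.Closeds F₁) =
        AlgebraicGeometry.Scheme.IdealSheafData.vanishingIdeal (⟨Z, hZ⟩ : TopologicalSpace.Closeds F₁) →
      Z ⊆ T₁ → ¬ T₁ ⊆ Z → (∀ z : ↥(redSub F₁ Z hZ), IsRegularLocalRing ((redSub F₁ Z hZ).presheaf.stalk z)) →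
      (∀ z : ↥(redSub F₁ Z hZ), IsClosed ({z} : Set ↥(redSub F₁ Z hZ)) → ringKrullDim ((redSub F₁ Z hZ).presheaf.stalk z) = ((1 : ℕ) : WithBot ℕ∞)) →
      (∀ z ∈ Z, IsClosed ({z} : Set F₁) → IsRegularLocalRing (F₁.presheaf.stalk z)) →
      (∀ K A' C' : Set F₁, Kp = some (K, A', C') → K ∈ Ls ∧ K ≠ A ∧ K ≠ B ∧ ((A' = A ∧ C' = B) ∨ (A' = B ∧ C' = A))) →
      (∀ L ∈ Ls, L ≠ A → L ≠ B → (∀ K A' C' : Set F₁, Kp = some (K, A', C') → L ≠ K) →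
        AlgebraicGeometry.Scheme.IdealSheafData.vanishingIdeal (⟨closure L, isClosed_closure⟩ : TopologicalSpace.Closeds F₁) ⊔
            AlgebraicGeometry.Scheme.IdealSheafData.vanishingIdeal (⟨Z, hZ⟩ : TopologicalSpace.Closeds F₁) =
          AlgebraicGeometry.Scheme.IdealSheafData.vanishingIdeal (⟨closure L ∩ Z, isClosed_closure.inter hZ⟩ : TopologicalSpace.Closeds F₁) ∧
        ∀ z ∈ Z, IsClosed ({z} : Set F₁) →
          ¬ Literature.AlgebraicGeometry.Resolution.stalkIdeal (AlgebraicGeometry.Scheme.IdealSheafData.vanishingIdeal (⟨closure L, isClosed_closure⟩ : TopologicalSpace.Closeds F₁)) z ≤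
            Literature.AlgebraicGeometry.Resolution.stalkIdeal (AlgebraicGeometry.Scheme.IdealSheafData.vanishingIdeal (⟨Z, hZ⟩ : TopologicalSpace.Closeds F₁)) z) →
      Literature.AlgebraicGeometry.Resolution.IsBlowup υ' (AlgebraicGeometry.Scheme.IdealSheafData.vanishingIdeal (⟨Z, hZ⟩ : TopologicalSpace.Closeds F₁)) →
      ∀ Ls' : List (Set F₃),
        (Ls' = Ls.map (fun L => closure (υ' ⁻¹' (closure L \ Z))) ∨ Ls' = Ls.map (fun L => closure (υ' ⁻¹' (closure L \ Z))) ++ [υ' ⁻¹' Z]) →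
        Q F₃ (υ' ≫ ρ) (closure (υ' ⁻¹' (T₁ \ Z))) Ls' none) →
    -- (HR) HOSTED ROUND₂ inside a listed host `E₁ ∈ Ls` (K5ʰ v2.2's stage-level clause VERBATIM: regular curve `Z ⊆ closure E₁ ∩ T`, `Ẽ` regular along `Z̃`,
    --      `DirStepUnobs` in the host, curve clause), every OTHER letter and the tag DROPPED: output `[St E₁] none` (supplier = ✓ `TCPlus.hround_seam` after projection)
    (∀ (F₁ F₃ : AlgebraicGeometry.Scheme.{0}) (ρ : F₁ ⟶ (Literature.AlgebraicGeometry.Motives.projectiveSpace n k).left) (T₁ : Set F₁) (Ls : List (Set F₁))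
        (Kp : Option (Set F₁ × Set F₁ × Set F₁)) (E₁ : Set F₁) (Z : Set F₁) (hZ : IsClosed Z) (υ' : F₃ ⟶ F₁),
      Q F₁ ρ T₁ Ls Kp → E₁ ∈ Ls → Z ⊆ closure E₁ → Z ⊆ T₁ → ¬ T₁ ⊆ Z → (∀ z : ↥(redSub F₁ Z hZ), IsRegularLocalRing ((redSub F₁ Z hZ).presheaf.stalk z)) →
      (∀ (i : redSub F₁ Z hZ ⟶ redSub F₁ (closure E₁) isClosed_closure), i ≫ redSubι F₁ (closure E₁) isClosed_closure = redSubι F₁ Z hZ →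
        ∀ z : ↥(redSub F₁ Z hZ), IsRegularLocalRing ((redSub F₁ (closure E₁) isClosed_closure).presheaf.stalk (i z))) → DirStepUnobs F₁ (closure E₁) isClosed_closure Z hZ →
      (∀ z : ↥(redSub F₁ Z hZ), IsClosed ({z} : Set ↥(redSub F₁ Z hZ)) → ringKrullDim ((redSub F₁ Z hZ).presheaf.stalk z) = ((1 : ℕ) : WithBot ℕ∞)) →
      Literature.AlgebraicGeometry.Resolution.IsBlowup υ' (AlgebraicGeometry.Scheme.IdealSheafData.vanishingIdeal (⟨Z, hZ⟩ : TopologicalSpace.Closeds F₁)) →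
      Q F₃ (υ' ≫ ρ) (closure (υ' ⁻¹' (T₁ \ Z))) [closure (υ' ⁻¹' (closure E₁ \ Z))] none) →
    -- END (C3): the final slots are existential
    ∃ (Ls : List (Set F')) (Kp : Option (Set F' × Set F' × Set F')), Q F' ρ' T' Ls Kp

/-! ## §B  The two junction lemmas over the literal text -/

variable {k : Type} [Field k] [IsAlgClosed k] {n : ℕ} {H : AlgebraicGeometry.Scheme.{0}}
  {ι : H ⟶ (Literature.AlgebraicGeometry.Motives.projectiveSpace n k).left}
  {Reach Reach₁ Reach₂ : ∀ (F₁ F₂ : AlgebraicGeometry.Scheme.{0}), (F₂ ⟶ F₁) → F₁ → Set F₂ → ∀ (F₉ : AlgebraicGeometry.Scheme.{0}), (F₉ ⟶ F₂) → Set F₉ → Prop}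
  {ReachL : ∀ (F₂ : AlgebraicGeometry.Scheme.{0}), (F₂ ⟶ (Literature.AlgebraicGeometry.Motives.projectiveSpace n k).left) →
      (Literature.AlgebraicGeometry.Motives.projectiveSpace n k).left → Set F₂ → List (Set F₂) → ∀ (F₉ : AlgebraicGeometry.Scheme.{0}), (F₉ ⟶ F₂) → Set F₉ → Prop}
  {LS : ∀ (F₂ : AlgebraicGeometry.Scheme.{0}), (F₂ ⟶ (Literature.AlgebraicGeometry.Motives.projectiveSpace n k).left) →
      (Literature.AlgebraicGeometry.Motives.projectiveSpace n k).left → List (Set F₂) → Prop}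
  {Open : ∀ (F₃ : AlgebraicGeometry.Scheme.{0}), (F₃ ⟶ (Literature.AlgebraicGeometry.Motives.projectiveSpace n k).left) → Set F₃ → List (Set F₃) →
      Option (Set F₃ × Set F₃ × Set F₃) → Prop}
  {F F' : AlgebraicGeometry.Scheme.{0}} {ρ : F ⟶ (Literature.AlgebraicGeometry.Motives.projectiveSpace n k).left} {T : Set F}
  {ρ' : F' ⟶ (Literature.AlgebraicGeometry.Motives.projectiveSpace n k).left} {T' : Set F'}

/-- **Monotonicity in `Reach`.**  If `Reach₁ ≤ Reach₂` pointwise, the prefix predicate for `Reach₁` implies the one for `Reach₂` (a motive closed under (Pc)[`Reach₂`] is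
closed under (Pc)[`Reach₁`]).  Use: `Reach₁ := ReachTowerBTriplePrime` (Defs8's blob), `Reach₂ := B‴ ∨ toric` (the engine), `hR := Or.inl`. [OURS · pure logic] -/
theorem prefixReach6Draft_mono_reach
    (hR : ∀ (F₁ F₂ : AlgebraicGeometry.Scheme.{0}) (υ : F₂ ⟶ F₁) (x : F₁) (T₂ : Set F₂) (F₉ : AlgebraicGeometry.Scheme.{0}) (β : F₉ ⟶ F₂) (T₉ : Set F₉),
      Reach₁ F₁ F₂ υ x T₂ F₉ β T₉ → Reach₂ F₁ F₂ υ x T₂ F₉ β T₉)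
    (hpre : PrefixReach6Draft k n H ι Reach₁ ReachL LS Open F ρ T) :
    PrefixReach6Draft k n H ι Reach₂ ReachL LS Open F ρ T := by
  intro Q hstart hD hPc hPL hi hO hii hHR
  refine hpre Q hstart hD ?_ hPL hi hO hii hHR
  intro F₁ F₂ ρ₁ T₁ Ls Kp x υ hx hQ hn hr hυ
  obtain ⟨h₁, h₂⟩ := hPc F₁ F₂ ρ₁ T₁ Ls Kp x υ hx hQ hn hr hυ
  exact ⟨h₁, fun F₉ β T₉ h₉ => h₂ F₉ β T₉ (hR _ _ _ _ _ _ _ _ h₉)⟩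

/-- **PREFIX then ND ROUNDS ⇒ PREFIX at the resolved end** (the K6-2P6 junction on text v1.1 AS WRITTEN), for any `Reach ⊇ ND.ReachToric n`.  `hQ'` is the first conjunct
delivered by ✓ `ND.rounds_resolve` (…NatNDStrataTower §13.9) between the prefix's END stage and the resolved stage. [OURS · pure logic: `junction6` inside `∀ Q`] -/
theorem prefixReach6Draft_then_rounds
    (hRT : ∀ (F₁ F₂ : AlgebraicGeometry.Scheme.{0}) (υ : F₂ ⟶ F₁) (x : F₁) (T₂ : Set F₂) (F₉ : AlgebraicGeometry.Scheme.{0}) (β : F₉ ⟶ F₂) (T₉ : Set F₉),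
      ND.ReachToric n F₁ F₂ υ x T₂ F₉ β T₉ → Reach F₁ F₂ υ x T₂ F₉ β T₉)
    (hpre : PrefixReach6Draft k n H ι Reach ReachL LS Open F ρ T)
    (hQ' : ∀ Q₃ : (∀ F₁ : AlgebraicGeometry.Scheme.{0}, (F₁ ⟶ (Literature.AlgebraicGeometry.Motives.projectiveSpace n k).left) → Set F₁ → Prop),
      ND.RoundClosed n k Q₃ → Q₃ F ρ T → Q₃ F' ρ' T') :
    PrefixReach6Draft k n H ι Reach ReachL LS Open F' ρ' T' := by
  intro Q hstart hD hPc hPL hi hO hii hHR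
  -- `junction6` INLINED (the Cruxes module `…NDLeavesRungK6Junction` is not a built library target, so it is not imported): apply `hQ'` to the COLLAPSED motive
  refine hQ' (fun F₁ ρ₁ T₁ => ∃ (Ls : List (Set F₁)) (Kp : Option (Set F₁ × Set F₁ × Set F₁)), Q F₁ ρ₁ T₁ Ls Kp) ?_ (hpre Q hstart hD hPc hPL hi hO hii hHR)
  -- the collapsed motive is `ND.RoundClosed`: READ OFF clause (Pc) (general slot premise, conclusions at `[] none`), toric towers via `hRT`
  intro F₁ F₂ ρ₁ T₁ x υ hx hQx hn hr hυ
  obtain ⟨Ls, Kp, hQx⟩ := hQx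
  obtain ⟨h₁, h₂⟩ := hPc F₁ F₂ ρ₁ T₁ Ls Kp x υ hx hQx hn hr hυ
  exact ⟨⟨[], none, h₁⟩, fun F₉ β T₉ h₉ => ⟨[], none, h₂ F₉ β T₉ (hRT _ _ _ _ _ _ _ _ h₉)⟩⟩

/-- **The RUNG's composite in one term**: Defs8-side prefix at `Reach₁` (e.g. `B‴`) + rounds ⇒ engine-side prefix at `Reach₂ ⊇ Reach₁ ∪ toric` at the resolved end.
[OURS · pure logic] -/
theorem prefixReach6Draft_end_of_prefix_then_rounds
    (hR : ∀ (F₁ F₂ : AlgebraicGeometry.Scheme.{0}) (υ : F₂ ⟶ F₁) (x : F₁) (T₂ : Set F₂) (F₉ : AlgebraicGeometry.Scheme.{0}) (β : F₉ ⟶ F₂) (T₉ : Set F₉),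
      Reach₁ F₁ F₂ υ x T₂ F₉ β T₉ → Reach₂ F₁ F₂ υ x T₂ F₉ β T₉)
    (hRT : ∀ (F₁ F₂ : AlgebraicGeometry.Scheme.{0}) (υ : F₂ ⟶ F₁) (x : F₁) (T₂ : Set F₂) (F₉ : AlgebraicGeometry.Scheme.{0}) (β : F₉ ⟶ F₂) (T₉ : Set F₉),
      ND.ReachToric n F₁ F₂ υ x T₂ F₉ β T₉ → Reach₂ F₁ F₂ υ x T₂ F₉ β T₉)
    (hpre : PrefixReach6Draft k n H ι Reach₁ ReachL LS Open F ρ T)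
    (hQ' : ∀ Q₃ : (∀ F₁ : AlgebraicGeometry.Scheme.{0}, (F₁ ⟶ (Literature.AlgebraicGeometry.Motives.projectiveSpace n k).left) → Set F₁ → Prop),
      ND.RoundClosed n k Q₃ → Q₃ F ρ T → Q₃ F' ρ' T') :
    PrefixReach6Draft k n H ι Reach₂ ReachL LS Open F' ρ' T' :=
  prefixReach6Draft_then_rounds hRT (prefixReach6Draft_mono_reach hR hpre) hQ'

/-! ## §C  PROBE: `PrefixReach6Draft … F' ρ' T'` IS the `∀ Q` block of the TREE ENGINE ✓ p669625 `target_elnat_of_letteredPrefixResolution` (definitional unfolding):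
the anonymous constructor `⟨F', ρ', T', h, hreg'⟩` is accepted as the engine's last hypothesis.  (If stub-2 re-files the engine with the arbitrated `Z.Infinite →`
binder in (ii), this probe breaks and §A must be re-pasted — by design: it is the tripwire.) -/
example : True := by
  have _probe := fun (p : ℕ) (hp : p.Prime) (k : Type) [Field k] [CharP k p] [IsAlgClosed k] (n : ℕ) (H : AlgebraicGeometry.Scheme.{0})
      (ι : H ⟶ (Literature.AlgebraicGeometry.Motives.projectiveSpace n k).left) (hι : AlgebraicGeometry.IsClosedImmersion ι) (hH : AlgebraicGeometry.IsIntegral H)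
      (hloc : ∀ y : (Literature.AlgebraicGeometry.Motives.projectiveSpace n k).left, ∃ U : (Literature.AlgebraicGeometry.Motives.projectiveSpace n k).left.affineOpens,
        y ∈ (U : (Literature.AlgebraicGeometry.Motives.projectiveSpace n k).left.Opens) ∧ (ι.ker.ideal U).IsPrincipal)
      (Reach : ∀ (F₁ F₂ : AlgebraicGeometry.Scheme.{0}), (F₂ ⟶ F₁) → F₁ → Set F₂ → ∀ (F₉ : AlgebraicGeometry.Scheme.{0}), (F₉ ⟶ F₂) → Set F₉ → Prop)
      (ReachL : ∀ (F₂ : AlgebraicGeometry.Scheme.{0}), (F₂ ⟶ (Literature.AlgebraicGeometry.Motives.projectiveSpace n k).left) →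
        (Literature.AlgebraicGeometry.Motives.projectiveSpace n k).left → Set F₂ → List (Set F₂) → ∀ (F₉ : AlgebraicGeometry.Scheme.{0}), (F₉ ⟶ F₂) → Set F₉ → Prop)
      (LS : ∀ (F₂ : AlgebraicGeometry.Scheme.{0}), (F₂ ⟶ (Literature.AlgebraicGeometry.Motives.projectiveSpace n k).left) →
        (Literature.AlgebraicGeometry.Motives.projectiveSpace n k).left → List (Set F₂) → Prop)
      (Open : ∀ (F₃ : AlgebraicGeometry.Scheme.{0}), (F₃ ⟶ (Literature.AlgebraicGeometry.Motives.projectiveSpace n k).left) → Set F₃ → List (Set F₃) →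
        Option (Set F₃ × Set F₃ × Set F₃) → Prop)
      HSUB₁ HSUB₂ HPT HOPEN HPAIR HROUND
      (F' : AlgebraicGeometry.Scheme.{0}) (ρ' : F' ⟶ (Literature.AlgebraicGeometry.Motives.projectiveSpace n k).left) (T' : Set F')
      (h : PrefixReach6Draft k n H ι Reach ReachL LS Open F' ρ' T')
      hreg' =>
    @target_elnat_of_letteredPrefixResolution p hp k _ _ _ n H ι hι hH hloc Reach ReachL LS Open HSUB₁ HSUB₂ HPT HOPEN HPAIR HROUND ⟨F', ρ', T', h, hreg'⟩
  trivial

#print axioms prefixReach6Draft_mono_reach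
#print axioms prefixReach6Draft_then_rounds
#print axioms prefixReach6Draft_end_of_prefix_then_rounds

end Summit.ResolutionOfSingularities.ResolutionOfSingularities.Cruxes.EquisingularLiftNatThree.ToricTowers.K6Junction.V11

end
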